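/-
Copyright (c) 2026 the pub-hodgecm-mathlib formalisation cell (harness21).  Prover seat hodgecm-mathlib-LH4-p08 (g4), Track A «(D-RAM) FOUR-FRAME», unit U2H, the census leaf
(ρ2b′-X) `stub_U2H_fixedPointCensus_typeTwo_unit0` — dealer LH4-plan (g12) WORD #16∕#21 hand T5a «TORIC LEVEL CENSUS, K-UNRAMIFIED» (payer LH4-p14; plan owner LH4-p12 (g4)):
the u-FREE LEVEL TABLE of the HYPERBOLIC side in CLOSED FORM over the ★ DEFS leaf `levelSet`.  2026-09-04.
-/
import Summits.HodgeConjecture.HodgeConjecture.Theorems.F0P3cDyRamToricCensusDefs   -- ★ p857239 (LH4-p12 (g4)): `IsOrd`, `dualGen`, `levelSet`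
import Literature.NumberTheory.LocalFields.QuadraticOrderLevelClasses              -- ★ p857397 (this seat, D1): level sets = index differences
import Literature.NumberTheory.LocalFields.QuadraticOrderTorusIndices               -- ★ p857326∕p857349 (this seat): Flicker index, Mars along `jK`, norm pull-back
import Literature.NumberTheory.LocalFields.WildQuadraticDatumTrace                  -- ★ skew parity `exists_v_eq_exp_of_map_eq_neg`
import HarnessLib

/-!
# T5a (type U, K-unramified): the u-free level table of the HYPERBOLIC side, closed form in `(q, d)`

For the M∕E-unramified four-involution frame in ONE-FIELD currency (`K` a model of `M = E·K_CM`, `ρ` = Gal(M∕E), `Θ` the adjoint involution fixing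
the third field `K♮`, `ϖE` a `ρ`-fixed uniformiser, `|α − ρα| = 1`), with the third field presented as its own valued field `K'` (datum `(σ', π', d)`,
residue field of size `q`) embedded by `jK : K' →+* K` onto the `Θ`-fixed elements, and the unit-norm surjectivity `hnorm` of the unramified `M∕K♮`:
the number of order lattices `x₀𝒪_j` with integral, Gram-primitive dual generator of level `a` for a HYPERBOLIC hermitian scalar `h` is

  `#levelSet(j,a) = (q² − 1)·q^{j − 2 − (j−a−d)∕2}`  if `1 ≤ a`, `a + d ≤ j`, `j − a − d` even;
  `= (q+1)·q^{(j+d)∕2 − 1}` if `a = 0`, `j + d` even, `d ≤ j`;   `= |G_j|` if `a = 0`, `j + d` even, `j < d`;   `= 0` otherwise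

(memo `T5a-LEVEL-TABLE.v2` §1; E1 130∕130 + r01 48∕48).  MECHANISM: ★ D1 (`levelSet = [B_{j−a} : 𝒪_jˣ] − [B_{j−a+1} : 𝒪_jˣ]`), ★ Flicker
(`[U_M : 𝒪_jˣ] = (q+1)q^{j−1}`), ★ norm pull-back (`[U_M : B_r] = [Ũ : Ṽ_r]`), ★ Mars along `jK` (`[Ũ : Ṽ_r] = q^{⌊(r+1−d)∕2⌋}`), and the PARITY `v(h) ≡ d (mod 2)`
of a hyperbolic scalar (its skew multiple `h·N_Θ(ω₀)` lies in `K♮`, ★ `exists_v_eq_exp_of_map_eq_neg`).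
HONEST LABEL: HC_CM is proved only modulo the 7 printed citations (2 remaining named inputs: hLiu418 = stmt-HodgeConjecture-24832,
h413 = stmt-HodgeConjecture-24833) until rung 0 closes; (ρ2b′-X) :418 is an OPEN prover target — this file is a helper (`--supports`), proofs only.
-/

set_option autoImplicit false

open WithZero IsLocalRing
open scoped Valued Pointwise

namespace Summit.HodgeConjecture.HodgeConjecture.Cruxes.H413.F0P3cDyRamToricLevelCensusUnr

open Summit.HodgeConjecture.HodgeConjecture.Cruxes.H413.F0P3cDyRamToricCensusDefs
open Literature.NumberTheory.LocalFields.QuadraticOrder Literature.NumberTheory.LocalFields.WildQuadraticDatum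

variable {K : Type*} [Field K] [Valued K ℤᵐ⁰] {ρ Θ : K →+* K} {α ϖE h : K} {d q : ℕ}
variable {K' : Type*} [Field K'] [Valued K' ℤᵐ⁰] {σ' : K' →+* K'} {π' : K'}

/-- `|jK π'^k| = exp(−k)` for an isometric embedding and a uniformiser `π'`. [cite: Serre1979, Ch. II §1] -/
theorem v_map_pow_eq_exp (hπ' : Valued.v π' = exp (-1 : ℤ)) (jK : K' →+* K) (hjv : ∀ x, Valued.v (jK x) = Valued.v x) (k : ℕ) :
    Valued.v (jK π' ^ k) = exp (-(k : ℤ)) := by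
  rw [map_pow, hjv, hπ', ← exp_nsmul, nsmul_eq_mul, mul_neg, mul_one]

/-- **THE NORM-DEPTH INDEX `[U_M : B_k] = q^{⌊(k + 1 − d)∕2⌋}`** (`= 1` for `k ≤ d`, `q^m` at `k = d + 2m`, `q^{m+1}` at `k = d + 2m + 1`): norm pull-back to the
Θ-fixed units (★ `relIndex_normDepth_eq`, unit-norm surjectivity `hnorm`) followed by Mars' index on the third field transported along `jK`
(★ `relIndex_thetaFixed_depth_eq_pow` ∕ `_odd_eq_pow` ∕ `_eq_one_of_le`). [cite: Serre1979, Ch. V §3] [cite: Flicker1998UnitaryFL, p. 84] -/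
theorem relIndex_normDepth_eq_pow_half (hvρ : ∀ x, Valued.v (ρ x) = Valued.v x) (hΘΘ : ∀ x, Θ (Θ x) = x) (hvΘ : ∀ x, Valued.v (Θ x) = Valued.v x)
    (hσ' : ∀ x, σ' (σ' x) = x) (hvσ' : ∀ x, Valued.v (σ' x) = Valued.v x) (hfix' : ∀ x : K', σ' x = x → x ≠ 0 → ∃ n : ℤ, Valued.v x = exp (2 * n))
    (hπ' : Valued.v π' = exp (-1 : ℤ)) (hdd' : Valued.v (π' - σ' π') = Valued.v π' ^ d) [IsDiscreteValuationRing 𝒪[K']] [Finite 𝓀[K']]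
    (hq' : Nat.card 𝓀[K'] = q) (jK : K' →+* K) (hjv : ∀ x, Valued.v (jK x) = Valued.v x) (hjΘ : ∀ x, Θ (jK x) = jK x)
    (hjfix : ∀ z : K, Θ z = z → ∃ x, jK x = z) (hjσ : ∀ x, jK (σ' x) = ρ (jK x))
    (hnorm : ∀ z : Kˣ, Θ (z : K) = z → Valued.v (z : K) = 1 → ∃ ω : Kˣ, Valued.v (ω : K) = 1 ∧ (ω : K) * Θ ω = z)
    (k : ℕ) (U B : Subgroup Kˣ) (hU : ∀ u, u ∈ U ↔ Valued.v (u : K) = 1)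
    (hB : ∀ ω, ω ∈ B ↔ Valued.v (ω : K) = 1 ∧ Valued.v ((ω : K) * Θ ω - ρ ((ω : K) * Θ ω)) ≤ exp (-(k : ℤ))) :
    B.relIndex U = q ^ ((k + 1 - d) / 2) := by
  obtain ⟨Ut, hUt⟩ := exists_subgroup_thetaFixed_units (Θ := Θ) (K := K)
  obtain ⟨Vt, hVt⟩ := exists_subgroup_thetaFixed_depth (Θ := Θ) hvρ (exp (-(k : ℤ)))
  rw [relIndex_normDepth_eq hΘΘ hvΘ hnorm _ U Ut Vt B hU hUt hVt hB]
  have hjle : ∀ x y, Valued.v (jK x) ≤ Valued.v (jK y) ↔ Valued.v x ≤ Valued.v y := fun x y => by rw [hjv, hjv]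
  have hvk := v_map_pow_eq_exp hπ' jK hjv
  rcases le_or_gt k d with hkd | hdk
  · -- low levels: index 1
    have hVt' : ∀ z, z ∈ Vt ↔ Θ (z : K) = z ∧ Valued.v (z : K) = 1 ∧ Valued.v ((z : K) - ρ z) ≤ Valued.v (jK π' ^ k) := fun z => by
      rw [hVt z, hvk]
    rw [relIndex_thetaFixed_depth_eq_one_of_le hσ' hvσ' hfix' hπ' hdd' jK hjle hjΘ hjfix hjσ hkd Ut Vt hUt hVt']
    have : (k + 1 - d) / 2 = 0 := by omega
    rw [this, pow_zero]
  · obtain ⟨m, hm | hm⟩ : ∃ m, k = d + 2 * m ∨ k = d + (2 * m + 1) := ⟨(k - d) / 2, by omega⟩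
    · have hVt' : ∀ z, z ∈ Vt ↔ Θ (z : K) = z ∧ Valued.v (z : K) = 1 ∧ Valued.v ((z : K) - ρ z) ≤ Valued.v (jK π' ^ (d + 2 * m)) := fun z => by
        rw [hVt z, hvk, hm]
      rw [relIndex_thetaFixed_depth_eq_pow hσ' hvσ' hfix' hπ' hdd' hq' jK hjv hjΘ hjfix hjσ m Ut Vt hUt hVt']
      congr 1; omega
    · have hVt' : ∀ z, z ∈ Vt ↔ Θ (z : K) = z ∧ Valued.v (z : K) = 1 ∧ Valued.v ((z : K) - ρ z) ≤ Valued.v (jK π' ^ (d + (2 * m + 1))) := fun z => by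
        rw [hVt z, hvk, hm]
      rw [relIndex_thetaFixed_depth_odd_eq_pow hσ' hvσ' hfix' hπ' hdd' hq' jK hjle hjΘ hjfix hjσ m Ut Vt hUt hVt']
      congr 1; omega


/-- The D1-shape of a level set: `levelSet` of the ★ DEFS leaf unfolded, with `|ϖE|^a = exp(−a)`. [cite: Jacobowitz1962, §4] -/
theorem levelSet_eq_setOf (hϖE : Valued.v ϖE = exp (-1 : ℤ)) (j a : ℕ) :
    levelSet ρ Θ α ϖE h j a =
      {Λ : AddSubgroup K | ∃ x₀ : K, x₀ ≠ 0 ∧ (∀ x, x ∈ Λ ↔ ∃ z, (Valued.v z ≤ 1 ∧ Valued.v (z - ρ z) ≤ Valued.v (ϖE ^ j * (α - ρ α))) ∧ x = x₀ * z) ∧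
        ((Valued.v (h * (x₀ * Θ x₀) * (ϖE ^ j * (α - ρ α))) ≤ 1 ∧
              Valued.v (h * (x₀ * Θ x₀) * (ϖE ^ j * (α - ρ α)) - ρ (h * (x₀ * Θ x₀) * (ϖE ^ j * (α - ρ α)))) ≤ Valued.v (ϖE ^ j * (α - ρ α))) ∧
            ¬ (Valued.v (h * (x₀ * Θ x₀) * (ϖE ^ j * (α - ρ α)) / ϖE) ≤ 1 ∧
                Valued.v (h * (x₀ * Θ x₀) * (ϖE ^ j * (α - ρ α)) / ϖE - ρ (h * (x₀ * Θ x₀) * (ϖE ^ j * (α - ρ α)) / ϖE)) ≤ Valued.v (ϖE ^ j * (α - ρ α)))) ∧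
          Valued.v (h * (x₀ * Θ x₀) * (ϖE ^ j * (α - ρ α))) = exp (-(a : ℤ))} := by
  have hϖa : Valued.v ϖE ^ a = exp (-(a : ℤ)) := by rw [hϖE, ← exp_nsmul, nsmul_eq_mul, mul_neg, mul_one]
  ext Λ
  simp only [levelSet, Set.mem_setOf_eq, IsOrd, dualGen, hϖa, and_assoc]

/-- **(UNR, HYPERBOLIC) — THE u-FREE LEVEL TABLE OF THE HYPERBOLIC SIDE, CLOSED FORM.**  For the M∕E-unramified frame (one-field currency) with third
field `K'` (datum `(σ', π', d)`, residue field of size `q`, embedded by `jK` onto the Θ-fixed elements), unit-norm surjectivity `hnorm`, residue field of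
`M` of size `q²`, and a HYPERBOLIC hermitian scalar `h` (an isotropic vector exists):
`#levelSet(j,a) = (q²−1)q^{j−2−(j−a−d)∕2}` (`1 ≤ a`, `a + d ≤ j`, `j ≡ a + d`), `(q+1)q^{(j+d)∕2−1}` (`a = 0`, `j ≡ d`, `d ≤ j`), `|G_j|` (`a = 0`, `j ≡ d`, `j < d`), else `0`.
[cite: Flicker1998UnitaryFL, p. 84] [cite: Serre1979, Ch. V §3] [cite: Jacobowitz1962, §4] -/
theorem ncard_levelSet_unr_hyper
    (hρρ : ∀ x, ρ (ρ x) = x) (hvρ : ∀ x, Valued.v (ρ x) = Valued.v x) (hΘΘ : ∀ x, Θ (Θ x) = x) (hΘρ : ∀ x, Θ (ρ x) = ρ (Θ x))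
    (hvΘ : ∀ x, Valued.v (Θ x) = Valued.v x) (hα1 : Valued.v α ≤ 1) (hα : Valued.v (α - ρ α) = 1)
    (hρϖE : ρ ϖE = ϖE) (hϖE : Valued.v ϖE = exp (-1 : ℤ)) (hΘh : Θ h = h) (hh : h ≠ 0)
    [IsDiscreteValuationRing 𝒪[K]] [Finite 𝓀[K]] (hq : Nat.card 𝓀[K] = q ^ 2)
    (hσ' : ∀ x, σ' (σ' x) = x) (hvσ' : ∀ x, Valued.v (σ' x) = Valued.v x) (hfix' : ∀ x : K', σ' x = x → x ≠ 0 → ∃ n : ℤ, Valued.v x = exp (2 * n))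
    (hπ' : Valued.v π' = exp (-1 : ℤ)) (hdd' : Valued.v (π' - σ' π') = Valued.v π' ^ d) (hd : 1 ≤ d) [IsDiscreteValuationRing 𝒪[K']] [Finite 𝓀[K']]
    (hq' : Nat.card 𝓀[K'] = q) (jK : K' →+* K) (hjv : ∀ x, Valued.v (jK x) = Valued.v x) (hjΘ : ∀ x, Θ (jK x) = jK x)
    (hjfix : ∀ z : K, Θ z = z → ∃ x, jK x = z) (hjσ : ∀ x, jK (σ' x) = ρ (jK x))
    (hnorm : ∀ z : Kˣ, Θ (z : K) = z → Valued.v (z : K) = 1 → ∃ ω : Kˣ, Valued.v (ω : K) = 1 ∧ (ω : K) * Θ ω = z)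
    (hhyper : ∃ x : K, x ≠ 0 ∧ h * Θ x * x + ρ (h * Θ x * x) = 0) (j a : ℕ) :
    (levelSet ρ Θ α ϖE h j a).ncard =
      if 1 ≤ a ∧ a + d ≤ j ∧ (j - a - d) % 2 = 0 then (q ^ 2 - 1) * q ^ (j - 2 - (j - a - d) / 2)
      else if a = 0 ∧ (j + d) % 2 = 0 then (if d ≤ j then (q + 1) * q ^ ((j + d) / 2 - 1) else (if j = 0 then 1 else (q + 1) * q ^ (j - 1)))
      else 0 := by
  classical
  have hq0 : 0 < q := hq' ▸ Nat.card_pos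
  -- (1) the unit translator `ω₀` (η·t(ω₀) = −1) and the PARITY `v(h) = exp(−(d − 2n))`
  obtain ⟨ω₀, hω₀, hη⟩ := exists_unit_twist_eq_of_isotropic hΘρ hϖE hρϖE hh hhyper
  have hN0 : (ω₀ : K) * Θ ω₀ ≠ 0 := mul_ne_zero ω₀.ne_zero ((map_ne_zero Θ).2 ω₀.ne_zero)
  have hNΘ : Θ ((ω₀ : K) * Θ ω₀) = (ω₀ : K) * Θ ω₀ := by rw [map_mul, hΘΘ, mul_comm]
  have hvN : Valued.v ((ω₀ : K) * Θ ω₀) = 1 := by rw [map_mul, hvΘ, hω₀, mul_one]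
  have hρs : ρ (h * ((ω₀ : K) * Θ ω₀)) = -(h * ((ω₀ : K) * Θ ω₀)) := by
    have hη' := hη
    rw [div_mul_div_comm, div_eq_iff (mul_ne_zero hh hN0), neg_one_mul] at hη'
    rw [map_mul, hη']
  obtain ⟨s', hs'⟩ := hjfix (h * ((ω₀ : K) * Θ ω₀)) (by rw [map_mul, hΘh, hNΘ])
  have hs'0 : s' ≠ 0 := by
    rintro rfl
    rw [map_zero] at hs'
    exact mul_ne_zero hh hN0 hs'.symm
  have hσs' : σ' s' = -s' := jK.injective (by rw [hjσ, hs', hρs, map_neg, hs'])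
  obtain ⟨n, hn⟩ := exists_v_eq_exp_of_map_eq_neg hσ' hfix' hπ' hdd' hσs' hs'0
  have hvh : Valued.v h = exp (-((d : ℤ) - 2 * n)) := by
    have h1 : Valued.v (jK s') = Valued.v h := by rw [hs', map_mul, hvN, mul_one]
    rw [← h1, hjv, hn]
    congr 1; ring
  -- (2) the subgroups: units `U`, order units `H = 𝒪_jˣ`, norm-depth subgroups `B_k` with their indices
  obtain ⟨U, hU⟩ := exists_subgroup_v_eq_one (K := K)
  obtain ⟨H, hH⟩ := exists_subgroup_orderUnits (ρ := ρ) (α := α) hvρ (ϖE ^ j)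
  have hvc : Valued.v (ϖE ^ j * (α - ρ α)) = exp (-(j : ℤ)) := by
    rw [map_mul, hα, mul_one, map_pow, hϖE, ← exp_nsmul, nsmul_eq_mul, mul_neg, mul_one]
  have hHU : H ≤ U := fun u hu => (hU u).2 ((hH u).1 hu).1
  have hHrel : H.relIndex U = if j = 0 then 1 else (q + 1) * q ^ (j - 1) := by
    split_ifs with hj0
    · subst hj0
      rw [Subgroup.relIndex_eq_one]
      intro u hu
      rw [hH]
      refine ⟨(hU u).1 hu, ?_⟩
      rw [hvc]
      refine (Valuation.map_sub _ _ _).trans ?_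
      rw [hvρ, (hU u).1 hu, max_self]; norm_num
    · have hH' : ∀ u, u ∈ H ↔ Valued.v (u : K) = 1 ∧ Valued.v ((u : K) - ρ u) ≤ Valued.v (ϖE ^ j) := fun u => by
        rw [hH u, map_mul Valued.v (ϖE ^ j), hα, mul_one]
      exact relIndex_orderUnits_eq_of_unramified hρρ hvρ hα1 hα hϖE hq (Nat.one_le_iff_ne_zero.2 hj0) U H hU hH'
  have hHU0 : H.relIndex U ≠ 0 := by
    rw [hHrel]; split_ifs
    · exact one_ne_zero
    · exact mul_ne_zero (by omega) (pow_ne_zero _ hq0.ne')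
  have hBk : ∀ k : ℕ, ∃ B : Subgroup Kˣ,
      (∀ ω, ω ∈ B ↔ Valued.v (ω : K) = 1 ∧ Valued.v ((ω : K) * Θ ω - ρ ((ω : K) * Θ ω)) ≤ exp (-(k : ℤ))) ∧
      B.relIndex U = q ^ ((k + 1 - d) / 2) ∧ B ≤ U ∧ (k ≤ j → H ≤ B) := fun k => by
    obtain ⟨B, hB⟩ := exists_subgroup_normDepth (Θ := Θ) hvρ hvΘ (exp (-(k : ℤ)))
    refine ⟨B, hB, relIndex_normDepth_eq_pow_half hvρ hΘΘ hvΘ hσ' hvσ' hfix' hπ' hdd' hq' jK hjv hjΘ hjfix hjσ hnorm k U B hU hB,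
      fun ω hω => (hU ω).2 ((hB ω).1 hω).1, fun hkj => ?_⟩
    exact orderUnits_le_normDepth hvρ hΘρ hvΘ (by rw [hvc, exp_le_exp]; omega) hH hB
  -- finiteness of the translated class sets
  have hfinB : ∀ B : Subgroup Kˣ, H ≤ B → B ≤ U → ((QuotientGroup.mk : Kˣ → Kˣ ⧸ H) '' (ω₀ • (B : Set Kˣ))).Finite := fun B hHB hBU => by
    apply Set.finite_of_ncard_ne_zero
    rw [ncard_image_mk_smul_subgroup H B ω₀]
    have hmul := Subgroup.relIndex_mul_relIndex H B U hHB hBU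
    exact left_ne_zero_of_mul (hmul.symm ▸ hHU0)
  -- (3) the level set in D1 shape
  rw [levelSet_eq_setOf hϖE]
  by_cases hpar : (j + a + d) % 2 = 0
  swap
  · -- ODD PARITY: empty (★ D1), and no branch of the closed form fires
    rw [ncard_levelSet_eq_zero_of_odd hvρ hvΘ hα hϖE hvh j a (fun k hk => by omega) H hH,
      if_neg (fun h1 => by omega), if_neg (fun h2 => by omega)]
  by_cases ha0 : a = 0
  · -- LEVEL 0: `[B_j : H]`
    subst ha0
    obtain ⟨B, hB, hBU, hBle, hHB⟩ := hBk j
    rw [ncard_levelSet_zero_eq_relIndex hρρ hvρ hΘρ hvΘ hα hϖE hρϖE hh hvh j (k₀ := n - ((j + d) / 2 : ℕ))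
      (by push_cast; omega) hω₀ hη H B hH hB]
    have hmul := Subgroup.relIndex_mul_relIndex H B U (hHB le_rfl) hBle
    rw [hBU, hHrel] at hmul
    rw [if_neg (by omega), if_pos ⟨rfl, by omega⟩]
    by_cases hdj : d ≤ j
    · -- d ≤ j (so j ≥ 1): `[B_j : H]·q^{(j−d)∕2} = (q+1)q^{j−1}`
      rw [if_pos hdj]
      rw [if_neg (by omega)] at hmul
      have he : (j + d) / 2 - 1 + (j + 1 - d) / 2 = j - 1 := by omega
      refine Nat.eq_of_mul_eq_mul_right (pow_pos hq0 ((j + 1 - d) / 2)) ?_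
      rw [hmul, mul_assoc, ← pow_add, he]
    · -- j < d: `[U : B_j] = 1`
      rw [if_neg hdj]
      have he : (j + 1 - d) / 2 = 0 := by omega
      rw [he, pow_zero, mul_one] at hmul
      exact hmul
  have ha1 : 1 ≤ a := Nat.one_le_iff_ne_zero.2 ha0
  by_cases haj : a ≤ j
  · -- 1 ≤ a ≤ j: `[B_{j−a} : H] − [B_{j−a+1} : H]`
    obtain ⟨B, hB, hBU, hBle, hHB⟩ := hBk (j - a)
    obtain ⟨B', hB', hB'U, hB'le, hHB'⟩ := hBk (j - a + 1)
    have e1 : (-((j - a : ℕ) : ℤ)) = -((j : ℤ) - a) := by omega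
    have e2 : (-((j - a + 1 : ℕ) : ℤ)) = -((j : ℤ) - a + 1) := by omega
    have hBD : ∀ ω : Kˣ, ω ∈ B ↔ Valued.v (ω : K) = 1 ∧ Valued.v ((ω : K) * Θ ω - ρ ((ω : K) * Θ ω)) ≤ exp (-((j : ℤ) - a)) :=
      fun ω => by rw [hB ω, e1]
    have hB'D : ∀ ω : Kˣ, ω ∈ B' ↔ Valued.v (ω : K) = 1 ∧ Valued.v ((ω : K) * Θ ω - ρ ((ω : K) * Θ ω)) ≤ exp (-((j : ℤ) - a + 1)) :=
      fun ω => by rw [hB' ω, e2]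
    rw [ncard_levelSet_eq_relIndex_sub hρρ hvρ hΘρ hvΘ hα hϖE hρϖE hh hvh j ha1 (k₀ := n - ((j + d - a) / 2 : ℕ))
      (by push_cast; omega) hω₀ hη H B B' hH hBD hB'D (hHB' (by omega)) (hfinB B (hHB (by omega)) hBle)]
    have hmul := Subgroup.relIndex_mul_relIndex H B U (hHB (by omega)) hBle
    have hmul' := Subgroup.relIndex_mul_relIndex H B' U (hHB' (by omega)) hB'le
    rw [hBU, hHrel, if_neg (by omega)] at hmul
    rw [hB'U, hHrel, if_neg (by omega)] at hmul'
    by_cases hadj : a + d ≤ j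
    · -- top region: r = j − a ≥ d, r − d even
      rw [if_pos ⟨ha1, hadj, by omega⟩]
      have he : (j - a + 1 - d) / 2 = (j - a - d) / 2 := by omega
      have he' : (j - a + 1 + 1 - d) / 2 = (j - a - d) / 2 + 1 := by omega
      rw [he] at hmul
      rw [he'] at hmul'
      have hX : H.relIndex B = (q + 1) * q ^ (j - 2 - (j - a - d) / 2 + 1) := by
        refine Nat.eq_of_mul_eq_mul_right (pow_pos hq0 ((j - a - d) / 2)) ?_
        rw [hmul, mul_assoc, ← pow_add]; congr 2; omega
      have hX' : H.relIndex B' = (q + 1) * q ^ (j - 2 - (j - a - d) / 2) := by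
        refine Nat.eq_of_mul_eq_mul_right (pow_pos hq0 ((j - a - d) / 2 + 1)) ?_
        rw [hmul', mul_assoc, ← pow_add]; congr 2; omega
      rw [hX, hX', pow_succ]
      have hq1 : 1 ≤ q ^ 2 := Nat.one_le_pow _ _ hq0
      have hle : (q + 1) * q ^ (j - 2 - (j - a - d) / 2) ≤ (q + 1) * (q ^ (j - 2 - (j - a - d) / 2) * q) :=
        Nat.mul_le_mul_left _ (Nat.le_mul_of_pos_right _ hq0)
      zify [hq1, hle]
      ring
    · -- low region: both indices are `|G_j|`
      rw [if_neg (by omega), if_neg (by omega)]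
      have he : (j - a + 1 - d) / 2 = 0 := by omega
      have he' : (j - a + 1 + 1 - d) / 2 = 0 := by omega
      rw [he, pow_zero, mul_one] at hmul
      rw [he', pow_zero, mul_one] at hmul'
      rw [hmul, hmul', Nat.sub_self]
  · -- a > j: both depth conditions are vacuous on units, the difference is `[U : H] − [U : H] = 0`
    have hvac : ∀ (t : ℤ), 0 ≤ t → ∀ ω : Kˣ, Valued.v (ω : K) = 1 →
        Valued.v ((ω : K) * Θ ω - ρ ((ω : K) * Θ ω)) ≤ exp t := fun t ht ω hω => by
      have hvN' : Valued.v ((ω : K) * Θ ω) = 1 := by rw [map_mul, hvΘ, hω, mul_one]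
      refine (Valuation.map_sub _ _ _).trans ?_
      rw [hvρ, hvN', max_self, ← exp_zero, exp_le_exp]; exact ht
    have hUD : ∀ ω : Kˣ, ω ∈ U ↔ Valued.v (ω : K) = 1 ∧ Valued.v ((ω : K) * Θ ω - ρ ((ω : K) * Θ ω)) ≤ exp (-((j : ℤ) - a)) :=
      fun ω => by rw [hU ω]; exact ⟨fun h1 => ⟨h1, hvac _ (by omega) ω h1⟩, fun h1 => h1.1⟩
    have hUD' : ∀ ω : Kˣ, ω ∈ U ↔ Valued.v (ω : K) = 1 ∧ Valued.v ((ω : K) * Θ ω - ρ ((ω : K) * Θ ω)) ≤ exp (-((j : ℤ) - a + 1)) :=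
      fun ω => by rw [hU ω]; exact ⟨fun h1 => ⟨h1, hvac _ (by omega) ω h1⟩, fun h1 => h1.1⟩
    rw [ncard_levelSet_eq_relIndex_sub hρρ hvρ hΘρ hvΘ hα hϖE hρϖE hh hvh j ha1 (k₀ := n + ((a : ℤ) - j - d) / 2)
      (by omega) hω₀ hη H U U hH hUD hUD' hHU (hfinB U hHU le_rfl)]
    rw [Nat.sub_self, if_neg (by omega), if_neg (by omega)]

end Summit.HodgeConjecture.HodgeConjecture.Cruxes.H413.F0P3cDyRamToricLevelCensusUnr
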